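import Summits.ResolutionOfSingularities.ResolutionOfSingularities.Theorems.FrobeniusClosingPatchingRelPerfectTwoPlanesPlaneTwoThree
import Summits.ResolutionOfSingularities.ResolutionOfSingularities.Theorems.FrobeniusClosingPatchingRelPerfectTwoPlanesExcCurveS
import HarnessLib

/-!
# Crux `PatchingRelPerfect` (stmt-ResolutionOfSingularities-16161), chain w52 — the rank-two member
# `f = x₀x₁ + x₂³`: the chart `B₂` of `Bl_𝔪` is RESOLVED by the companion factors (unconditional)

[OURS · L1 W5.2 · rung] On the chart `B₂` (`u = x₂`) of `Bl_𝔪 Spec S`, every blowing up along the image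
of `𝔪ᴺ · A · A₃ · A₄ · I` (`A = (f) + x₀𝔪 + 𝔪³`, `A₃ = (f) + 𝔪³`, `A₄ = (f) + x₀𝔪² + 𝔪⁴`, `I = (f) + 𝔪⁴`)
is regular — `…TwoPlanesPlaneTwoThree.isRegular_of_isBlowup_tpPlane₂₃` at `i = 2` with its five
exceptional-curve hypotheses discharged by `…TwoPlanesExcCurveT.excCurveT_facts` (graph) and
`…TwoPlanesExcCurveS.excCurveS_isRegularRing_two` / `excCurveS_ne_zero_two` (hyperbola).  With
`…TwoPlanesSideZero` (chart `B₀`) two of the four charts of the rank-two member are now settled; `B₁`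
(unit variants) and `B₃` (the `A₂` spot on the `s`-chart) remain (design note NEXT-two-planes-cube.md,
Addendum 6).

* `isRegular_of_isBlowup_tpPlane_two`.

`S` regular local of dimension four with regular system of parameters `x`; nothing here is a statement
of the manuscript under review.

## References

* The Stacks Project, Tags 080A, 080B, 0BIQ. [StacksProject]
-/

-- `Summit.<Summit>.<Sub>.Theorems` with `Sub = Summit` (single-conjunct summit, D-0017)
set_option linter.dupNamespace false

noncomputable section

open CategoryTheory CategoryTheory.Limits AlgebraicGeometry Literature.AlgebraicGeometry.Resolution
open IsLocalRing

namespace Summit.ResolutionOfSingularities.ResolutionOfSingularities.Theorems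

namespace TwoPlanesRung

open ConeRung

universe u

section ChartTwo

variable {S : Type u} [CommRing S] [IsRegularLocalRing S] (x : Fin 4 → S)
  (hx : Ideal.span (Set.range x) = IsLocalRing.maximalIdeal S)
  (hd : (IsLocalRing.maximalIdeal S).spanFinrank = 4)

local notation3 "M" => Ideal.span (Set.range x)
local notation3 "fT" => x 0 * x 1 + x 2 ^ 3

/-- `2 ≠ 0`, `2 ≠ 1` in `Fin 4`. [folklore] -/
theorem two_ne_zero_fin4' : (2 : Fin 4) ≠ 0 := by decide

/-- `2 ≠ 1` in `Fin 4`. [folklore] -/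
theorem two_ne_one_fin4' : (2 : Fin 4) ≠ 1 := by decide

include hx hd in
/-- **The chart `B₂` of the rank-two member is resolved by the companion factors** (unconditional).
[cite: StacksProject, Tag 080A] [cite: StacksProject, Tag 080B] -/
theorem isRegular_of_isBlowup_tpPlane_two (N : ℕ) {Y : Scheme.{u}} {ρ : Y ⟶ Spec (.of (chartRing x 2))}
    (hρ : IsBlowup ρ (affineBlowup.idealSheaf
      ((M ^ N * (Ideal.span {fT} ⊔ Ideal.span {x 0} * M ⊔ M ^ 3) * (Ideal.span {fT} ⊔ M ^ 3) *
        (Ideal.span {fT} ⊔ Ideal.span {x 0} * M ^ 2 ⊔ M ^ 4) * (Ideal.span {fT} ⊔ M ^ 4)).map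
          (chartBase x 2)))) :
    Scheme.IsRegular Y := by
  obtain ⟨hPd, hPr, hPX⟩ := excCurveT_facts x hx hd 2 two_ne_zero_fin4' two_ne_one_fin4'
  exact isRegular_of_isBlowup_tpPlane₂₃ x hx hd 2 two_ne_zero_fin4' two_ne_one_fin4' N hPd hPr hPX
    (excCurveS_isRegularRing_two x hx hd) (excCurveS_ne_zero_two x hx hd) hρ

end ChartTwo

end TwoPlanesRung

end Summit.ResolutionOfSingularities.ResolutionOfSingularities.Theorems

end
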